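/-
Copyright: lit-balaban cell, Phase-2 proof seat p33 (reserve R4).  Reproduction of a published argument; nothing is claimed beyond
what the kernel checks below.
-/
import Mathlib
import Literature.MathematicalPhysics.QuantumFieldTheory.Balaban1983to89.B6TreeGaugePoincare

/-!
# `BalabanImbrieJaffe1984to88.BIJ85NoZeroModes309Proof` — T. Bałaban, J. Imbrie, A. Jaffe, *Renormalization of the Higgs
model: minimizers, propagators and the stability of mean field theory*, Commun. Math. Phys. **97** (1985) 299–329
[BalabanImbrieJaffe1985]: the «no zero modes» claim of Sect. 4.1, p. 309, for k = 1 — PROVED, following the printed argument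

statement-level skeleton of published theorems with citation tags; proofs where landed; nothing here is a claim about
the Yang–Mills mass gap

PDF held: `paper:balaban1985-cmp97-bij-higgs-minimizers` (journal page = PDF page + 298); p. 309 [PDF 11] (the claim and its
proof sketch), pp. 302–304 [PDF 4–6] (blocks (2.4), contours Γ_{yx}, the axial tree, the bond average (2.13)) and p. 306
[PDF 8] ((3.4)) read on the held text.

WHAT IS PRINTED (p. 309 [PDF 11], verbatim).  *"The reader may wonder whether ∂ has zero modes on the subspace of gauge
fields satisfying Q_kA = 0 and satisfying the axial gauge condition. Such zero modes do not occur, and as a consequence the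
integral (4.1.1) is convergent also for noncompact gauge fields. A proof of this fact for k = 1 follows by considering on
each plaquette in a lattice block the condition dA = 0 and the axial gauge condition. This shows that A can be nonzero only
on bonds connecting different blocks, and it must be constant on the bonds connecting two given blocks. The condition QA = 0
then ensures that A is everywhere zero. Similar, elementary reasoning yields an inductive proof for k > 1, but we leave out
the details."*  The objects: blocks (2.4) p. 302 *"B(y) consists of points x = (x₁, …, x_d) such that Ln_j ≤ x_j < L(n_j + 1),
j = 1, 2, …, d"* (y = Ln a corner); contours p. 302–303 *"Define Γ_{yx} as the path obtained by following the coordinate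
axis one, then axis two, …, etc., in going from x to y"*; the axial gauge p. 303 *"we choose h in order to set u_b = 1 for
every b which occurs in some Γ_{yx}. In other words, we specify a maximal tree T(y) in each block B(y) composed of bonds in any
Γ_{yx}, x ∈ B(y)"*, (3.4) p. 306 *"δ_{Ax}(u) = Π_{y∈T_L} Π_{b∈T(y)} δ(u_b)"*; the linear bond average (2.13) p. 304
*"(QA)_{b′} = L^{−(d+1)} Σ_{x∈B(b′₋)} Σ_{b∈Γ_{xx′}} A_b, (2.13) where Γ_{xx′} is the special contour from x to x′ and xx′ is
the parallel transport of the bond b′ to start at x. Thus the bonds b which enter the sum (2.13) range over the interior of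
the two L-blocks B(b′₋) and B(b′₊), as well as the (surface) bonds connecting these blocks."*

WHAT IS REPRODUCED.  SKELETON row `C1.Eq4.1.1-4.1.2` (`HOME/lit-balaban-r15/ROWS-C1.md` r15-C1-38) — its CLAIM part, for
k = 1, = `HOME/PHASE2-TARGETS.md` §G.3 reserve **R4** («C1 p. 309 no-zero-modes claim for k = 1 (finite linear algebra on one
block)»): `noZeroModes_k1` below, with the three printed steps as separate theorems (`inner_eq_zero` = *"A can be nonzero
only on bonds connecting different blocks"*, `const_on_face` = *"it must be constant on the bonds connecting two given
blocks"*, `avg213_eq_face` + `noZeroModes_k1` = *"The condition QA = 0 then ensures that A is everywhere zero"*).  NOT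
reproduced: the functional integral (4.1.1) itself and the convergence consequence (a statement about a Gaussian integral
on the finite torus), and the case k > 1 (*"we leave out the details"*).

CARRIER (dictionary; no new carrier).  The concrete unit-lattice carrier of `…Balaban1983to89.B6BondElimination` /
`…B6TreeGaugePoincare` (cell `pub-balaban`): sites `Fin d → ℤ`, unit bonds `(Fin d → ℤ) × Fin d` = ⟨z, z + e_μ⟩, real bond
configurations `B6TreeGaugePoincare.Cfg d` (the noncompact abelian field A of p. 309), CORNER-anchored blocks
`B6Elimination.block L y` = B5 (1.6) = BIJ (2.4) (y ∈ Lℤ^d), the trees `B6BondElimination.treeBonds L y` = the bonds of the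
contours Γ_{y,x} of B5 (1.7) (from y: axis d first, …, axis one last — i.e. *"axis one, then axis two, …, in going from x
to y"*, BIJ p. 302, verbatim the same contours; fidelity `B6BondElimination.axial_iff`) = T(y) of (3.4), the plaquette
variable `B6TreeGaugePoincare.curl` (B5 (1.4) = dA), and (2.13) = B5 (1.11) typed here as `avg213` on configurations of ALL
bonds (the region-indexed `B6BondElimination.avgQ` is the same formula, `avgQ_eq_avg213`).  The theorem is stated for EVERY
configuration on the bonds of ℤ^d with the three printed conditions at EVERY block y ∈ Lℤ^d; the paper's periodic unit
lattice T₁ (side N, L ∣ N) is the case of N-periodic configurations (its blocks, trees, plaquettes and L-bonds are those of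
ℤ^d read modulo N), to which the theorem applies verbatim.  The series' other typed axial gauges (`LatticeFieldCalculus.IsAxial`,
`Setup.AxialGauge`: CENTRED blocks, B12 convention) are not BIJ's corner convention and are not used.

Unit `lit-balaban-p33` (literature-prover-lit-balaban-p33-0), HOME `run/shared/lean/pub/lit-balaban/` (seat dir
`lit-balaban-p33/`), 2026-08-21.
-/

open Finset

namespace Literature.MathematicalPhysics.QuantumFieldTheory.BalabanImbrieJaffe1984to88.BIJ85NoZeroModes309Proof

open Literature.MathematicalPhysics.QuantumFieldTheory.Balaban1983to89
open B6Elimination (block mem_block corner corner_apply mem_block_corner card_block)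
open B6BondElimination (unitVec unitVec_apply add_unitVec_apply add_smul_unitVec_apply treeBonds mem_treeBonds contour
  axial_iff extB avgQ)
open B6TreeGaugePoincare (Cfg curl bond_eq_sum_curl segCurl)

noncomputable section

variable {d L : ℕ}

/-! ## §1  The bond average (2.13) on configurations of all unit bonds -/

/-- **(2.13)** p. 304 [PDF 6], verbatim: *"(QA)_{b′} = L^{−(d+1)} Σ_{x∈B(b′₋)} Σ_{b∈Γ_{xx′}} A_b, (2.13) where Γ_{xx′} is the
special contour from x to x′ and xx′ is the parallel transport of the bond b′ to start at x"* — for the L-lattice bond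
b′ = ⟨y, y + Le_μ⟩, recorded as `(y, μ)`, the contour Γ_{xx′} from x ∈ B(y) to x′ = x + Le_μ consists of the unit bonds
⟨x + se_μ, x + (s+1)e_μ⟩, s = 0, …, L − 1 (typed reading = B5 (1.11), the formula of `B6BondElimination.avgQ`, here for a
configuration on all bonds). [cite: BalabanImbrieJaffe1985, (2.13) p.304] -/
def avg213 (L : ℕ) (A : Cfg d) (c : (Fin d → ℤ) × Fin d) : ℝ :=
  ((L : ℝ) ^ (d + 1))⁻¹ * ∑ x ∈ block L c.1, ∑ s ∈ range L, A (x + (s : ℤ) • unitVec c.2, c.2)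

/-- Consistency with the tree's typed B5 (1.11) = BIJ (2.13): the region-indexed average `B6BondElimination.avgQ` of a
family of bond variables on Ω ⊂ ℤ^d is `avg213` of its zero extension. [cite: BalabanImbrieJaffe1985, (2.13) p.304] -/
theorem avgQ_eq_avg213 {Ω : Finset (Fin d → ℤ)} (B : B4.Idx Ω d → ℝ) (c : (Fin d → ℤ) × Fin d) :
    avgQ L B c = avg213 L (fun b => extB B b.1 b.2) c := by
  unfold avgQ avg213
  rw [mul_sum]

/-! ## §2  Step 1 of the printed proof: inside a block, dA = 0 and the axial gauge kill A -/

/-- p. 309, first step, verbatim: *"A proof of this fact for k = 1 follows by considering on each plaquette in a lattice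
block the condition dA = 0 and the axial gauge condition. This shows that A can be nonzero only on bonds connecting
different blocks"* — for a bond ⟨x, x + e_μ⟩ with both end points in B(y), dA = 0 and A = 0 on the tree T(y) give
A(x, x + e_μ) = 0 (the bond telescopes along the comb of T(y) into plaquette variables, `B6TreeGaugePoincare.bond_eq_sum_curl`).
[cite: BalabanImbrieJaffe1985, §4.1 p.309] -/
theorem inner_eq_zero (A : Cfg d) (hcurl : ∀ (z : Fin d → ℤ) (j μ : Fin d), j < μ → curl A z j μ = 0)
    {y x : Fin d → ℤ} (hax : ∀ b ∈ treeBonds L y, A b = 0) (hx : x ∈ block L y) {μ : Fin d}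
    (hμ : x μ + 1 < y μ + L) : A (x, μ) = 0 := by
  rw [bond_eq_sum_curl hx μ hμ A hax]
  refine sum_eq_zero fun j hj => sum_eq_zero fun s _ => ?_
  exact hcurl _ _ _ (mem_filter.1 hj).2

/-! ## §3  Step 2: A is constant on the bonds connecting two given blocks -/

/-- The block across the face of B(y) in the direction μ is B(y + Le_μ); its corner is again in Lℤ^d. [folklore] -/
private theorem dvd_shift {y : Fin d → ℤ} (hy : ∀ i, (L : ℤ) ∣ y i) (μ : Fin d) (i : Fin d) :
    (L : ℤ) ∣ (y + (L : ℤ) • unitVec μ) i := by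
  rw [add_smul_unitVec_apply]
  split_ifs
  · exact dvd_add (hy i) (dvd_refl _)
  · simpa using hy i

/-- A point z of B(y) shifted by te_μ with z_μ + t ∈ [y_μ + L, y_μ + 2L) lies in the block B(y + Le_μ). [folklore] -/
private theorem mem_block_shift {y z : Fin d → ℤ} (hz : z ∈ block L y) {μ : Fin d} {t : ℤ}
    (h1 : y μ + L ≤ z μ + t) (h2 : z μ + t < y μ + L + L) :
    z + t • unitVec μ ∈ block L (y + (L : ℤ) • unitVec μ) := by
  rw [mem_block] at hz ⊢
  intro i
  rw [add_smul_unitVec_apply, add_smul_unitVec_apply]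
  by_cases hi : i = μ
  · subst hi
    simp only [if_true]
    constructor <;> omega
  · simp only [if_neg hi, add_zero]
    exact hz i

/-- p. 309, second step: across the face between B(y) and B(y + Le_μ), two neighbouring connecting bonds ⟨z, z + e_μ⟩ and
⟨z + e_ν, z + e_ν + e_μ⟩ (z, z + e_ν ∈ B(y), z_μ = y_μ + L − 1) carry the same value of A: the plaquette through them has
dA = 0 and its two other bonds lie inside B(y), resp. inside B(y + Le_μ), where A vanishes by Step 1.
[cite: BalabanImbrieJaffe1985, §4.1 p.309] -/
theorem face_step (A : Cfg d) (hcurl : ∀ (z : Fin d → ℤ) (j μ : Fin d), j < μ → curl A z j μ = 0)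
    (hax : ∀ y : Fin d → ℤ, (∀ i, (L : ℤ) ∣ y i) → ∀ b ∈ treeBonds L y, A b = 0)
    {y : Fin d → ℤ} (hy : ∀ i, (L : ℤ) ∣ y i) {z : Fin d → ℤ} (hz : z ∈ block L y) {μ ν : Fin d}
    (hzμ : z μ + 1 = y μ + L) (hνμ : ν ≠ μ) (hν : z ν + 1 < y ν + L) :
    A (z + unitVec ν, μ) = A (z, μ) := by
  -- the bond ⟨z, z + e_ν⟩ lies inside B(y)
  have h1 : A (z, ν) = 0 := inner_eq_zero A hcurl (hax y hy) hz hν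
  -- the bond ⟨z + e_μ, z + e_μ + e_ν⟩ lies inside B(y + Le_μ)
  have hz' : z + unitVec μ ∈ block L (y + (L : ℤ) • unitVec μ) := by
    have hL : (0 : ℤ) < L := by have := (mem_block.1 hz μ); omega
    have := mem_block_shift hz (μ := μ) (t := 1) (by omega) (by omega)
    simpa using this
  have hν' : (z + unitVec μ) ν + 1 < (y + (L : ℤ) • unitVec μ) ν + L := by
    rw [add_unitVec_apply, add_smul_unitVec_apply, if_neg hνμ, if_neg hνμ]
    simpa using hν
  have h2 : A (z + unitVec μ, ν) = 0 := inner_eq_zero A hcurl (hax _ (dvd_shift hy μ)) hz' hν'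
  rcases lt_or_gt_of_ne hνμ with h | h
  · have hc := hcurl z ν μ h
    simp only [curl] at hc
    linarith
  · have hc := hcurl z μ ν h
    simp only [curl] at hc
    linarith

/-- The face base point (y₁, …, y_μ + L − 1, …, y_d) lies in B(y) (L ≥ 1). [folklore] -/
private theorem update_mem_block (hL : 1 ≤ L) (y : Fin d → ℤ) (μ : Fin d) :
    Function.update y μ (y μ + L - 1) ∈ block L y := by
  rw [mem_block]
  intro i
  by_cases hi : i = μ
  · subst hi
    simp only [Function.update_self]
    constructor <;> omega
  · rw [Function.update_of_ne hi]
    constructor <;> omega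

/-- Every connecting bond ⟨z, z + e_μ⟩, z ∈ B(y), z_μ = y_μ + L − 1, carries the value of A at the face base point
(y₁, …, y_μ + L − 1, …, y_d): induction on Σ_{i ≠ μ} (z_i − y_i), one `face_step` at a time. [cite: BalabanImbrieJaffe1985, §4.1 p.309] -/
theorem face_eq_base (A : Cfg d) (hcurl : ∀ (z : Fin d → ℤ) (j μ : Fin d), j < μ → curl A z j μ = 0)
    (hax : ∀ y : Fin d → ℤ, (∀ i, (L : ℤ) ∣ y i) → ∀ b ∈ treeBonds L y, A b = 0)
    {y : Fin d → ℤ} (hy : ∀ i, (L : ℤ) ∣ y i) {μ : Fin d} {z : Fin d → ℤ} (hz : z ∈ block L y)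
    (hzμ : z μ + 1 = y μ + L) :
    A (z, μ) = A (Function.update y μ (y μ + L - 1), μ) := by
  -- the measure Σ_{i ≠ μ} (z_i − y_i) is a natural number k
  have hnn : ∀ z ∈ block L y, ∀ i, 0 ≤ z i - y i := fun z hz i => by have := (mem_block.1 hz i).1; omega
  obtain ⟨k, hk⟩ : ∃ k : ℕ, ∑ i ∈ univ.erase μ, (z i - y i) = k :=
    ⟨(∑ i ∈ univ.erase μ, (z i - y i)).toNat, (Int.toNat_of_nonneg (sum_nonneg fun i _ => hnn z hz i)).symm⟩
  induction k generalizing z with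
  | zero =>
    -- all coordinates i ≠ μ agree with y: z is the base point
    have hzero : ∀ i ∈ univ.erase μ, z i - y i = 0 :=
      (sum_eq_zero_iff_of_nonneg fun i _ => hnn z hz i).1 (by simpa using hk)
    have hzb : z = Function.update y μ (y μ + L - 1) := by
      funext i
      by_cases hi : i = μ
      · subst hi
        rw [Function.update_self]
        omega
      · rw [Function.update_of_ne hi]
        have := hzero i (mem_erase.2 ⟨hi, mem_univ i⟩)
        omega
    rw [hzb]
  | succ k ih =>
    -- some coordinate ν ≠ μ has z_ν > y_ν
    obtain ⟨ν, hνmem, hνpos⟩ : ∃ ν ∈ univ.erase μ, 0 < z ν - y ν := by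
      by_contra hcon
      push Not at hcon
      have : ∑ i ∈ univ.erase μ, (z i - y i) = 0 :=
        sum_eq_zero fun i hi => le_antisymm (hcon i hi) (hnn z hz i)
      rw [this] at hk
      exact absurd hk (by positivity)
    have hνμ : ν ≠ μ := (mem_erase.1 hνmem).1
    -- step back: z₀ = z − e_ν ∈ B(y), z = z₀ + e_ν
    set z₀ : Fin d → ℤ := z - unitVec ν with hz₀
    have hzz : z = z₀ + unitVec ν := by rw [hz₀, sub_add_cancel]
    have hz₀i : ∀ i, z₀ i = z i - (if i = ν then 1 else 0) := fun i => by
      rw [hz₀, Pi.sub_apply, unitVec_apply]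
    have hz₀mem : z₀ ∈ block L y := by
      rw [mem_block] at hz ⊢
      intro i
      rw [hz₀i]
      have := hz i
      by_cases hi : i = ν
      · subst hi; rw [if_pos rfl]; omega
      · rw [if_neg hi]; omega
    have hz₀μ : z₀ μ + 1 = y μ + L := by rw [hz₀i, if_neg hνμ.symm]; omega
    have hz₀ν : z₀ ν + 1 < y ν + L := by
      rw [hz₀i, if_pos rfl]
      have := (mem_block.1 hz ν).2
      omega
    have hsum : ∑ i ∈ univ.erase μ, (z₀ i - y i) = k := by
      have hsplit : ∑ i ∈ univ.erase μ, (z i - y i) = ∑ i ∈ univ.erase μ, (z₀ i - y i) + 1 := by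
        rw [← sum_erase_add _ _ hνmem, ← sum_erase_add (univ.erase μ) (fun i => z₀ i - y i) hνmem]
        have hrest : ∑ i ∈ (univ.erase μ).erase ν, (z i - y i) = ∑ i ∈ (univ.erase μ).erase ν, (z₀ i - y i) :=
          sum_congr rfl fun i hi => by rw [hz₀i, if_neg (mem_erase.1 hi).1]; ring
        rw [hrest, hz₀i, if_pos rfl]
        ring
      rw [hsplit] at hk
      push_cast at hk
      linarith
    rw [hzz, face_step A hcurl hax hy hz₀mem hz₀μ hνμ hz₀ν]
    exact ih hz₀mem hz₀μ hsum

/-- p. 309, second step, verbatim: *"and it must be constant on the bonds connecting two given blocks"* — A takes one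
value on all the bonds ⟨z, z + e_μ⟩ connecting B(y) to B(y + Le_μ) (z ∈ B(y), z_μ = y_μ + L − 1).
[cite: BalabanImbrieJaffe1985, §4.1 p.309] -/
theorem const_on_face (A : Cfg d) (hcurl : ∀ (z : Fin d → ℤ) (j μ : Fin d), j < μ → curl A z j μ = 0)
    (hax : ∀ y : Fin d → ℤ, (∀ i, (L : ℤ) ∣ y i) → ∀ b ∈ treeBonds L y, A b = 0)
    {y : Fin d → ℤ} (hy : ∀ i, (L : ℤ) ∣ y i) {μ : Fin d} {z z' : Fin d → ℤ} (hz : z ∈ block L y)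
    (hz' : z' ∈ block L y) (hzμ : z μ + 1 = y μ + L) (hz'μ : z' μ + 1 = y μ + L) :
    A (z, μ) = A (z', μ) := by
  rw [face_eq_base A hcurl hax hy hz hzμ, face_eq_base A hcurl hax hy hz' hz'μ]

/-! ## §4  Step 3: the condition QA = 0 -/

/-- Along the special contour Γ_{xx′} from x ∈ B(y) to x′ = x + Le_μ all bonds but the one crossing the face lie inside
B(y) or inside B(y + Le_μ) (p. 304: *"the bonds b which enter the sum (2.13) range over the interior of the two L-blocks
B(b′₋) and B(b′₊), as well as the (surface) bonds connecting these blocks"*), so by Steps 1–2 the contour sum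
Σ_{b∈Γ_{xx′}} A_b is the common face value. [cite: BalabanImbrieJaffe1985, (2.13) p.304] -/
theorem contourSum_eq_face (A : Cfg d) (hcurl : ∀ (z : Fin d → ℤ) (j μ : Fin d), j < μ → curl A z j μ = 0)
    (hax : ∀ y : Fin d → ℤ, (∀ i, (L : ℤ) ∣ y i) → ∀ b ∈ treeBonds L y, A b = 0)
    {y : Fin d → ℤ} (hy : ∀ i, (L : ℤ) ∣ y i) (μ : Fin d) {x : Fin d → ℤ} (hx : x ∈ block L y) :
    ∑ s ∈ range L, A (x + (s : ℤ) • unitVec μ, μ) = A (Function.update y μ (y μ + L - 1), μ) := by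
  have hxμ := mem_block.1 hx μ
  -- the index of the crossing bond on the contour
  set s₀ : ℕ := (y μ + L - 1 - x μ).toNat with hs₀
  have hs₀' : (s₀ : ℤ) = y μ + L - 1 - x μ := by rw [hs₀]; exact Int.toNat_of_nonneg (by omega)
  have hs₀mem : s₀ ∈ range L := by rw [mem_range]; omega
  have key : ∀ s ∈ range L, A (x + (s : ℤ) • unitVec μ, μ) =
      if s = s₀ then A (Function.update y μ (y μ + L - 1), μ) else 0 := by
    intro s hs
    rw [mem_range] at hs
    have hcoord : ∀ i, (x + (s : ℤ) • unitVec μ) i = x i + if i = μ then (s : ℤ) else 0 :=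
      fun i => add_smul_unitVec_apply x s μ i
    split_ifs with hss
    · -- the crossing bond: a face bond of B(y)
      subst hss
      have hzmem : x + (s₀ : ℤ) • unitVec μ ∈ block L y := by
        rw [mem_block] at hx ⊢
        intro i
        rw [hcoord]
        have := hx i
        by_cases hi : i = μ
        · subst hi; rw [if_pos rfl]; omega
        · rw [if_neg hi]; omega
      exact face_eq_base A hcurl hax hy hzmem (by rw [hcoord, if_pos rfl]; omega)
    · have hne : x μ + (s : ℤ) ≠ y μ + L - 1 := fun h => hss (by omega)
      rcases lt_or_gt_of_ne hne with hlt | hgt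
      · -- inside B(y)
        have hzmem : x + (s : ℤ) • unitVec μ ∈ block L y := by
          rw [mem_block] at hx ⊢
          intro i
          rw [hcoord]
          have := hx i
          by_cases hi : i = μ
          · subst hi; rw [if_pos rfl]; omega
          · rw [if_neg hi]; omega
        exact inner_eq_zero A hcurl (hax y hy) hzmem (by rw [hcoord, if_pos rfl]; omega)
      · -- inside B(y + Le_μ)
        have hzmem : x + (s : ℤ) • unitVec μ ∈ block L (y + (L : ℤ) • unitVec μ) :=
          mem_block_shift hx (by omega) (by omega)
        refine inner_eq_zero A hcurl (hax _ (dvd_shift hy μ)) hzmem (μ := μ) ?_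
        rw [hcoord, if_pos rfl, add_smul_unitVec_apply, if_pos rfl]
        omega
  rw [sum_congr rfl key, sum_ite_eq' (range L) s₀, if_pos hs₀mem]

/-- (2.13) evaluated on the constrained configurations: (QA)(⟨y, y + Le_μ⟩) = L^{−(d+1)} · L^d · (the common face value) =
L^{−1} × the value of A on the bonds connecting B(y) to B(y + Le_μ). [cite: BalabanImbrieJaffe1985, (2.13) p.304] -/
theorem avg213_eq_face (hL : 1 ≤ L) (A : Cfg d)
    (hcurl : ∀ (z : Fin d → ℤ) (j μ : Fin d), j < μ → curl A z j μ = 0)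
    (hax : ∀ y : Fin d → ℤ, (∀ i, (L : ℤ) ∣ y i) → ∀ b ∈ treeBonds L y, A b = 0)
    {y : Fin d → ℤ} (hy : ∀ i, (L : ℤ) ∣ y i) (μ : Fin d) :
    avg213 L A (y, μ) = ((L : ℝ))⁻¹ * A (Function.update y μ (y μ + L - 1), μ) := by
  unfold avg213
  rw [sum_congr rfl fun x hx => contourSum_eq_face A hcurl hax hy μ hx, sum_const, card_block, nsmul_eq_mul]
  have hL0 : (L : ℝ) ≠ 0 := by exact_mod_cast (by omega : L ≠ 0)
  push_cast
  field_simp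
  ring

/-! ## §5  The claim: no zero modes of ∂ on {QA = 0} ∩ (axial gauge), k = 1 -/

/-- **The «no zero modes» claim of p. 309, k = 1** (verbatim: *"The reader may wonder whether ∂ has zero modes on the
subspace of gauge fields satisfying Q_kA = 0 and satisfying the axial gauge condition. Such zero modes do not occur … A proof
of this fact for k = 1 follows by considering on each plaquette in a lattice block the condition dA = 0 and the axial gauge
condition. This shows that A can be nonzero only on bonds connecting different blocks, and it must be constant on the bonds
connecting two given blocks. The condition QA = 0 then ensures that A is everywhere zero."*): a real configuration A on the
unit bonds with dA = 0 on every plaquette, A_b = 0 on the axial trees T(y) ((3.4)) of all blocks B(y), y ∈ Lℤ^d, and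
(QA)_{b′} = 0 ((2.13)) for all L-lattice bonds b′, vanishes identically (L ≥ 1; every dimension d).
[cite: BalabanImbrieJaffe1985, §4.1 p.309] -/
theorem noZeroModes_k1 (hL : 1 ≤ L) (A : Cfg d)
    (hcurl : ∀ (z : Fin d → ℤ) (j μ : Fin d), j < μ → curl A z j μ = 0)
    (hax : ∀ y : Fin d → ℤ, (∀ i, (L : ℤ) ∣ y i) → ∀ b ∈ treeBonds L y, A b = 0)
    (hQ : ∀ y : Fin d → ℤ, (∀ i, (L : ℤ) ∣ y i) → ∀ μ : Fin d, avg213 L A (y, μ) = 0) :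
    A = 0 := by
  funext ⟨z, μ⟩
  show A (z, μ) = 0
  have hL0 : 0 < L := hL
  -- the block of z
  have hy : ∀ i, (L : ℤ) ∣ corner L z i := fun i => ⟨z i / (L : ℤ), corner_apply z i⟩
  have hz : z ∈ block L (corner L z) := mem_block_corner hL0 z
  by_cases hμ : z μ + 1 < corner L z μ + L
  · -- a bond inside the block
    exact inner_eq_zero A hcurl (hax _ hy) hz hμ
  · -- a bond connecting B(y) to B(y + Le_μ): its value is L · (QA)(⟨y, y + Le_μ⟩) = 0
    have hzμ : z μ + 1 = corner L z μ + L := by have := (mem_block.1 hz μ).2; omega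
    have hq := hQ _ hy μ
    rw [avg213_eq_face hL A hcurl hax hy μ] at hq
    have hL' : ((L : ℝ))⁻¹ ≠ 0 := inv_ne_zero (by exact_mod_cast hL0.ne')
    rw [face_eq_base A hcurl hax hy hz hzμ]
    exact (mul_eq_zero.1 hq).resolve_left hL'

/-- The same claim with the axial gauge written as in B5 (1.10) / BIJ p. 303, *"u_b = 1 for every b which occurs in some
Γ_{yx}"* read contour by contour: A(Γ_{y,x}) = Σ_{b∈Γ_{yx}} A_b = 0 for every x ∈ B(y), x ≠ y (equivalent to vanishing on
the tree T(y), `B6BondElimination.axial_iff`). [cite: BalabanImbrieJaffe1985, §4.1 p.309] -/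
theorem noZeroModes_k1_contour (hL : 1 ≤ L) (A : Cfg d)
    (hcurl : ∀ (z : Fin d → ℤ) (j μ : Fin d), j < μ → curl A z j μ = 0)
    (hax : ∀ y : Fin d → ℤ, (∀ i, (L : ℤ) ∣ y i) → ∀ x ∈ block L y, x ≠ y → ∑ b ∈ contour L y x, A b = 0)
    (hQ : ∀ y : Fin d → ℤ, (∀ i, (L : ℤ) ∣ y i) → ∀ μ : Fin d, avg213 L A (y, μ) = 0) :
    A = 0 :=
  noZeroModes_k1 hL A hcurl (fun y hy => (axial_iff y A).1 (hax y hy)) hQ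

/-- Linear-algebra form of the claim (∂ is injective on the constrained subspace): two configurations in the axial gauge
with the same plaquette variables dA₁ = dA₂ and the same averages QA₁ = QA₂ coincide. [cite: BalabanImbrieJaffe1985, §4.1 p.309] -/
theorem eq_of_curl_eq_of_avg213_eq (hL : 1 ≤ L) (A₁ A₂ : Cfg d)
    (hcurl : ∀ (z : Fin d → ℤ) (j μ : Fin d), j < μ → curl A₁ z j μ = curl A₂ z j μ)
    (hax₁ : ∀ y : Fin d → ℤ, (∀ i, (L : ℤ) ∣ y i) → ∀ b ∈ treeBonds L y, A₁ b = 0)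
    (hax₂ : ∀ y : Fin d → ℤ, (∀ i, (L : ℤ) ∣ y i) → ∀ b ∈ treeBonds L y, A₂ b = 0)
    (hQ : ∀ y : Fin d → ℤ, (∀ i, (L : ℤ) ∣ y i) → ∀ μ : Fin d, avg213 L A₁ (y, μ) = avg213 L A₂ (y, μ)) :
    A₁ = A₂ := by
  have h := noZeroModes_k1 hL (A₁ - A₂)
    (fun z j μ hjμ => by
      have := hcurl z j μ hjμ
      simp only [curl, Pi.sub_apply] at this ⊢
      linarith)
    (fun y hy b hb => by rw [Pi.sub_apply, hax₁ y hy b hb, hax₂ y hy b hb, sub_zero])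
    (fun y hy μ => by
      have := hQ y hy μ
      simp only [avg213, Pi.sub_apply, sum_sub_distrib, mul_sub] at this ⊢
      linarith)
  exact sub_eq_zero.1 h

end

end Literature.MathematicalPhysics.QuantumFieldTheory.BalabanImbrieJaffe1984to88.BIJ85NoZeroModes309Proof
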